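import Literature.MathematicalPhysics.QuantumFieldTheory.Balaban1983to89.B9Eq3152StoreyHTwoHolderMembers
import Literature.MathematicalPhysics.QuantumFieldTheory.Balaban1983to89.B9Eq342GreenPrimeDstarValueRowTower

/-!
# `Balaban1983to89.B9Eq3152StoreyHValueMemberClosed` — T. Bałaban, *Propagators for lattice gauge theories in a background field*, Commun. Math. Phys. **99** (1985) 389–434
# [Balaban1985BackgroundPropagators] Thm 3.13 p. 426, Thm 3.1 (3.42)–(3.44) pp. 397–398, with [Balaban1985Variational] (117) p. 295: **STOREY H WITH THE VALUE MEMBER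
# DISCHARGED — the (117) socket for the FULL `𝔊̃_k` ON THE CELL's MODEL now rests on (HLaH) = [B9] Thm 3.1 (3.43)₂ (the HÖLDER member alone) for `G′_kD*_U`
# and (HLb) = Thm 3.1 (3.44) for `G′_k`: the VALUE member of `B9Eq3152StoreyHTwoHolderMembers`'s (HLa₀) is this lineage's
# `B9Eq342GreenPrimeDstarValueRowTower.exists_valueRow_GpOfUk_covDiv`** — NE9 crux-team LEAF PROVER 01, gen 93

statement-level skeleton of published theorems with citation tags; proofs where landed; nothing here is a claim about the Yang–Mills mass gap

CITATION HEADER (lean-in-tree rule).  Audit cell `pub-balaban`, sub-cell `t4`, BINDER row NE9; filed by NE9 crux-team LEAF PROVER 01 (`b2b-balaban-t4-ne9-formalise-leaf-01`,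
gen 93; bears_on: R4/N22).  Source READ first-hand (`paper:balaban1985-cmp99-background-propagators`, pp. 394, 396–398, 426).  COMPOSED BY NAME:
`B9Eq3152StoreyHTwoHolderMembers.exists_norm_toCLM115_frakGkPi_le_of_twoHolderMembers` (gen 92), `B9Eq342GreenPrimeDstarValueRowTower.exists_valueRow_GpOfUk_covDiv`
(gen 93: (3.42)₃ with decay for `G′_kD*_U` on the model, by the perturbation of the covariant massive resolvent around `U = 1`).  Nothing printed is a hypothesis.

WHAT IS PROVED (sorry-free; proof lane — 0 `def`; [folklore] bookkeeping of `∃`-first constants: `min` of thresholds and rates, `max` of constants).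
* **`twoMembers_of_holderMember`** — (HLa₀) [value ∧ Hölder for `G′_kD*_U`, (T4E) block] ⇐ (HLaH) [the Hölder member alone, same block]: the value conjunct is
  `exists_valueRow_GpOfUk_covDiv` read on the block (its binders are a subset of the block's: `hw`, `hUb`, `hUη`, `hUgrad`, `εU`-letters, `hUst`, `hRlev`, `hpos′`).
* **`exists_norm_toCLM115_frakGkPi_le_of_holderMember_hessian`** — THE HEADLINE OF STOREY H with (HLa₀) replaced by (HLaH): the (117) socket
  `‖toCLM115 ∇_U 𝔊̃_k‖ ≤ max(w̄₀B, w̄₁B)·w̲⁻¹` for the FULL `𝔊̃_k` ⇐ (HLaH) ∧ (HLb).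
HONEST SCOPE.  After this file the (117) VALUE∕GRADIENT programme for `𝔊̃_k` on the MODEL rests on EXACTLY: (HLaH) = [B9] Thm 3.1 (3.43)₂ for `G′_kD*_U` (η-scale Hölder
member, plain pair differences over `tdist ≤ L^{n+1}`) and (HLb) = Thm 3.1 (3.44) for `G′_k` — both DISPLAYED, not supplied; the located road for (HLaH) is the Hölder
twin of this generation's perturbation (flat input: the Hölder row of `∇(L₀+m)⁻¹`, NOT in the tree — [B4] (1.9) at `A = 0` is kernel-checked on lit-balaban's torus carrier
only).  «NE9 ⇐ the named binders»; NE9 NOT PRINTED ∕ NOT PROVED; row WALLED ON A MODEL (O-NE9-1; #5 UNRULED); spine PROVED 0∕9; rung (B)+1 finite T⁴ — NOT infinite volume,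
NOT mass gap, NOT BetaPertH, NOT Clay.  HONEST DEPENDENCY (cell line): continuum YM on T⁴ ⇐ BetaPertH ∧ nine spine estimates (0/9 proved); BetaPertH ⇐ (D1) ∧ (D4) ∧ CAP+tail;
G-an2-4 gates asym, D1 and NE2/3/4.  NEW file; nothing modified.  Net new unproved facts: 0.
-/

noncomputable section

set_option autoImplicit false

open scoped InnerProductSpace ComplexConjugate BigOperators

namespace Literature.MathematicalPhysics.QuantumFieldTheory.Balaban1983to89.B9Eq3152StoreyHValueMemberClosed

open B4Sect5Torus (TSite tdist tdist_nonneg)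
open B9SectCLatticeCarrier (Bond bpos btgt unshift)
open B9Eq311L2Pairing (WL2)
open B9Eq319QprimeTorus (fineP blockCoord)
open B7Prop1Explicit (U1 Wcx boxVec)
open B11Eq103H1Complex (SiteL2K BondL2K greenK covDerivL2K covDivL2K G1LatticeK frakGLatticeK)
open B9Eq310DeltaPrime (plaqHolU)
open B9Eq310HessianOperator (adTransportW)
open B9Eq315QTorus (perCfg cornerSite)
open B9Eq315QTower (towerP UlevOf)
open B9Eq316TowerFlatIsOneStep (towerP_eq_fineP_pow siteCast)
open B9Eq326OperatorTower (QprimeTowerW RofUk laplaceAk QkW)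
open B9Eq3119DeltaPiTower (laplaceAkPi)
open B9Eq324DeltaPrimeATower (laplacePrimeAk GpOfUk)
open B9Eq325ProjFormulaTower (QGGQk_pos_of_unitary)
open B9Eq33CovDerivVector (covGrad)
open B11Eq115Space (NegSup levWeight)
open B11Eq111FrakG (toCLM115)
open B9Eq3152StoreyHTwoHolderMembers (exists_norm_toCLM115_frakGkPi_le_of_twoHolderMembers)
open B9Eq342GreenPrimeDstarValueRowTower (exists_valueRow_GpOfUk_covDiv)

variable {d : ℕ} (hd : 1 ≤ d) (L : ℕ) [NeZero L] (hL : 1 ≤ L) (hL3 : 3 ≤ L)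
  {𝔸 : Type*} [NormedRing 𝔸] [NormedAlgebra ℂ 𝔸] [CompleteSpace 𝔸] [NormOneClass 𝔸] [StarRing 𝔸] [NormedStarGroup 𝔸] [StarModule ℂ 𝔸]
  {W : Type*} [NormedAddCommGroup W] [InnerProductSpace ℂ W] [FiniteDimensional ℂ W] (φ : W ≃ₗ[ℂ] 𝔸)
  {Mφ Mφ' : ℝ} (hMφ : 0 ≤ Mφ) (hMφ' : 0 ≤ Mφ') (hφ : ∀ w, ‖φ w‖ ≤ Mφ * ‖w‖) (hφ' : ∀ X, ‖φ.symm X‖ ≤ Mφ' * ‖X‖) (hstar : ∀ X : 𝔸, ‖star X‖ ≤ ‖X‖)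
  {a : ℝ} (ha : 0 < a) {a' : ℝ} (ha' : 0 < a') {ϱ : ℝ} (hϱ0 : 0 ≤ ϱ) (hϱ1 : ϱ < 1)
  (τ : 𝔸 →ₗ[ℂ] ℂ) {Cτ : ℝ} (hτ : ∀ X, ‖τ X‖ ≤ Cτ * ‖X‖) (hCτ : 0 ≤ Cτ) {Mτ : ℝ} (hτm : ∀ X Y : 𝔸, ‖τ (X * Y)‖ ≤ Mτ * ‖X‖ * ‖Y‖) (hMτ : 0 ≤ Mτ)
  {ρw : ℝ} (hρw : 0 ≤ ρw)
  (hτ₁ : ∀ X : 𝔸, τ (star X) = conj (τ X)) (hτ₂ : ∀ X Y : 𝔸, τ (X * Y) = τ (Y * X)) (hφτ : ∀ X Y : 𝔸, ⟪φ.symm X, φ.symm Y⟫_ℂ = τ (star X * Y))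
  (AQ : ℝ)

set_option maxHeartbeats 800000 in -- two ≈ 50-binder blocks
omit [NormedStarGroup 𝔸] in
include hd hL3 hMφ hMφ' hφ hφ' ha' hϱ0 hϱ1 hτ₂ hφτ in
/-- **(HLa₀) ⇐ (HLaH): the VALUE member of (HLa₀) is supplied** by `B9Eq342GreenPrimeDstarValueRowTower.exists_valueRow_GpOfUk_covDiv` (threshold `min`, constant `max`,
rate `min`); the Hölder member is (HLaH) verbatim. [folklore] [cite: Balaban1985BackgroundPropagators, Thm 3.1 (3.42)–(3.43) pp.397–398, (3.24)–(3.25) p.394] -/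
theorem twoMembers_of_holderMember
    (HLaH : ∃ ε αa Ba δa : ℝ, 0 < ε ∧ ε ≤ 1 ∧ 0 < αa ∧ 0 ≤ Ba ∧ 0 < δa ∧
      ∀ (n : ℕ) (η : ℝ) (_hηL : η * (L : ℝ) ^ (n + 1) = 1) (c₀ c₁ : ℝ) [Fact (0 < c₀)] [Fact (0 < c₁)]
        (_hw : c₀ * ((L : ℝ) ^ (n + 1)) ^ d = c₁) (_hρ : |η| ^ d / c₀ ≤ ρw) (m : Fin d → ℕ) [∀ i, NeZero (m i)] (_hm : ∀ i, 1 ≤ m i)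
        (U : Bond d (towerP L m (n + 1)) → 𝔸ˣ) (αU : ℕ → ℝ) (_hα0 : ∀ j, 0 ≤ αU j) (hα1 : ∀ j, αU j ≤ 1 / 64)
        (hU1 : ∀ (j : ℕ) (x : B7Prop1Explicit.Site d) (k : Fin d), perCfg (towerP L m (j + 1)) (UlevOf L m (n + 1) U j) x k ∈ U1 𝔸)
        (hreg : ∀ (j : ℕ) (y : TSite d (towerP L m j)) (k : Fin d) (ρ' : Fin d → Fin L),
          ‖((Wcx L (perCfg (towerP L m (j + 1)) (UlevOf L m (n + 1) U j)) (cornerSite L y) k (boxVec L ρ') : 𝔸ˣ) : 𝔸) - 1‖ ≤ αU j)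
        (εU : ℕ → ℝ) (_hεU : ∀ j, 0 ≤ εU j) (_hUε : ∀ (j : ℕ) (b : Bond d (towerP L m (j + 1))), ‖(UlevOf L m (n + 1) U j b : 𝔸) - 1‖ ≤ εU j)
        (_hLb : ∀ (j : ℕ) (b : Bond d (towerP L m (j + 1))), UlevOf L m (n + 1) U j b ∈ U1 𝔸)
        (α : ℝ) (_hα : 0 ≤ α) (_hαle : α ≤ αa)
        (hUst : ∀ b, star (U b : 𝔸) = (((U b)⁻¹ : 𝔸ˣ) : 𝔸)) (_hUb : ∀ b, U b ∈ U1 𝔸) (_hUη : ∀ b, ‖(U b : 𝔸) - 1‖ ≤ α * η)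
        (_hpl : ∀ p : B9SectCLatticeCarrier.Plaq d (towerP L m (n + 1)), ‖(plaqHolU U p : 𝔸) - 1‖ ≤ α * η ^ 2)
        (_hUgrad : ∀ (x : TSite d (towerP L m (n + 1))) (μ : Fin d), ‖(U (x, μ) : 𝔸) - U (unshift μ x, μ)‖ ≤ α * η ^ 2)
        (_hRlev : ∀ (j : ℕ) (b : Bond d (towerP L m (j + 1))) (w : W), ‖adTransportW φ (UlevOf L m (n + 1) U j) b w‖ ≤ ‖w‖)
        (_hεg : ∀ j < n + 1, εU j ≤ α * ϱ ^ j) (_hAQ : ∑ j ∈ Finset.range (n + 1), αU j ≤ AQ)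
        (hpos' : ∀ x : SiteL2K ℂ d (towerP L m (n + 1)) c₀ W, x ≠ 0 → 0 < RCLike.re ⟪x, laplacePrimeAk L m n φ η U a' (c₁ := c₁) x⟫_ℂ)
        (hpos : ∀ x : BondL2K ℂ d (towerP L m (n + 1)) c₀ W, x ≠ 0 →
          0 < RCLike.re ⟪x, laplaceAk L m n φ η U hL αU hα1 hU1 hreg τ (c₀ := c₀) (c₁ := c₁) a x⟫_ℂ)
        (hposπ : ∀ x : BondL2K ℂ d (towerP L m (n + 1)) c₀ W, x ≠ 0 →
          0 < RCLike.re ⟪x, laplaceAkPi L m n φ τ η U a' hpos' hL αU hα1 hU1 hreg (c₁ := c₁) a x⟫_ℂ)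
        (_hc₀ : c₀ = η ^ d)
        (_hJ : ∀ (μ : Fin d) (y : TSite d (towerP L m (n + 1))),
          ‖B9Eq39Adjoint.J (fun μ => B9Eq33CovDerivVector.shiftEquiv μ) (fun μ y => U (y, μ)) η μ y‖ ≤ α)
        (v : TSite d m) (f : BondL2K ℂ d (towerP L m (n + 1)) c₀ W) (F : ℝ)
        (_hfv : ∀ b, blockCoord (L ^ (n + 1)) m (siteCast (towerP_eq_fineP_pow L m (n + 1)) (bpos b)) ≠ v →
          WL2.equiv ℂ (fun _ : Bond d (towerP L m (n + 1)) => c₀) W f b = 0)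
        (_hfF : ∀ b, ‖WL2.equiv ℂ (fun _ : Bond d (towerP L m (n + 1)) => c₀) W f b‖ ≤ F) (x : TSite d (towerP L m (n + 1))),
        ∀ x' : TSite d (towerP L m (n + 1)), tdist (towerP L m (n + 1)) x x' ≤ ((L ^ (n + 1) : ℕ) : ℝ) →
          ‖WL2.equiv ℂ (fun _ : TSite d (towerP L m (n + 1)) => c₀) W (GpOfUk L m n φ η U a' (c₁ := c₁) hpos' (covDivL2K ℂ c₀ ((η : ℂ))⁻¹ (adTransportW φ fun bb => (U bb)⁻¹) f)) x' - WL2.equiv ℂ (fun _ : TSite d (towerP L m (n + 1)) => c₀) W (GpOfUk L m n φ η U a' (c₁ := c₁) hpos' (covDivL2K ℂ c₀ ((η : ℂ))⁻¹ (adTransportW φ fun bb => (U bb)⁻¹) f)) x‖ ≤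
            Ba * Real.exp (-(δa * tdist m (blockCoord (L ^ (n + 1)) m (siteCast (towerP_eq_fineP_pow L m (n + 1)) x)) v)) * (tdist (towerP L m (n + 1)) x x' / ((L ^ (n + 1) : ℕ) : ℝ)) ^ ε * F) :
    ∃ ε αa Ba δa : ℝ, 0 < ε ∧ ε ≤ 1 ∧ 0 < αa ∧ 0 ≤ Ba ∧ 0 < δa ∧
      ∀ (n : ℕ) (η : ℝ) (_hηL : η * (L : ℝ) ^ (n + 1) = 1) (c₀ c₁ : ℝ) [Fact (0 < c₀)] [Fact (0 < c₁)]
        (_hw : c₀ * ((L : ℝ) ^ (n + 1)) ^ d = c₁) (_hρ : |η| ^ d / c₀ ≤ ρw) (m : Fin d → ℕ) [∀ i, NeZero (m i)] (_hm : ∀ i, 1 ≤ m i)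
        (U : Bond d (towerP L m (n + 1)) → 𝔸ˣ) (αU : ℕ → ℝ) (_hα0 : ∀ j, 0 ≤ αU j) (hα1 : ∀ j, αU j ≤ 1 / 64)
        (hU1 : ∀ (j : ℕ) (x : B7Prop1Explicit.Site d) (k : Fin d), perCfg (towerP L m (j + 1)) (UlevOf L m (n + 1) U j) x k ∈ U1 𝔸)
        (hreg : ∀ (j : ℕ) (y : TSite d (towerP L m j)) (k : Fin d) (ρ' : Fin d → Fin L),
          ‖((Wcx L (perCfg (towerP L m (j + 1)) (UlevOf L m (n + 1) U j)) (cornerSite L y) k (boxVec L ρ') : 𝔸ˣ) : 𝔸) - 1‖ ≤ αU j)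
        (εU : ℕ → ℝ) (_hεU : ∀ j, 0 ≤ εU j) (_hUε : ∀ (j : ℕ) (b : Bond d (towerP L m (j + 1))), ‖(UlevOf L m (n + 1) U j b : 𝔸) - 1‖ ≤ εU j)
        (_hLb : ∀ (j : ℕ) (b : Bond d (towerP L m (j + 1))), UlevOf L m (n + 1) U j b ∈ U1 𝔸)
        (α : ℝ) (_hα : 0 ≤ α) (_hαle : α ≤ αa)
        (hUst : ∀ b, star (U b : 𝔸) = (((U b)⁻¹ : 𝔸ˣ) : 𝔸)) (_hUb : ∀ b, U b ∈ U1 𝔸) (_hUη : ∀ b, ‖(U b : 𝔸) - 1‖ ≤ α * η)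
        (_hpl : ∀ p : B9SectCLatticeCarrier.Plaq d (towerP L m (n + 1)), ‖(plaqHolU U p : 𝔸) - 1‖ ≤ α * η ^ 2)
        (_hUgrad : ∀ (x : TSite d (towerP L m (n + 1))) (μ : Fin d), ‖(U (x, μ) : 𝔸) - U (unshift μ x, μ)‖ ≤ α * η ^ 2)
        (_hRlev : ∀ (j : ℕ) (b : Bond d (towerP L m (j + 1))) (w : W), ‖adTransportW φ (UlevOf L m (n + 1) U j) b w‖ ≤ ‖w‖)
        (_hεg : ∀ j < n + 1, εU j ≤ α * ϱ ^ j) (_hAQ : ∑ j ∈ Finset.range (n + 1), αU j ≤ AQ)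
        (hpos' : ∀ x : SiteL2K ℂ d (towerP L m (n + 1)) c₀ W, x ≠ 0 → 0 < RCLike.re ⟪x, laplacePrimeAk L m n φ η U a' (c₁ := c₁) x⟫_ℂ)
        (hpos : ∀ x : BondL2K ℂ d (towerP L m (n + 1)) c₀ W, x ≠ 0 →
          0 < RCLike.re ⟪x, laplaceAk L m n φ η U hL αU hα1 hU1 hreg τ (c₀ := c₀) (c₁ := c₁) a x⟫_ℂ)
        (hposπ : ∀ x : BondL2K ℂ d (towerP L m (n + 1)) c₀ W, x ≠ 0 →
          0 < RCLike.re ⟪x, laplaceAkPi L m n φ τ η U a' hpos' hL αU hα1 hU1 hreg (c₁ := c₁) a x⟫_ℂ)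
        (_hc₀ : c₀ = η ^ d)
        (_hJ : ∀ (μ : Fin d) (y : TSite d (towerP L m (n + 1))),
          ‖B9Eq39Adjoint.J (fun μ => B9Eq33CovDerivVector.shiftEquiv μ) (fun μ y => U (y, μ)) η μ y‖ ≤ α)
        (v : TSite d m) (f : BondL2K ℂ d (towerP L m (n + 1)) c₀ W) (F : ℝ)
        (_hfv : ∀ b, blockCoord (L ^ (n + 1)) m (siteCast (towerP_eq_fineP_pow L m (n + 1)) (bpos b)) ≠ v →
          WL2.equiv ℂ (fun _ : Bond d (towerP L m (n + 1)) => c₀) W f b = 0)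
        (_hfF : ∀ b, ‖WL2.equiv ℂ (fun _ : Bond d (towerP L m (n + 1)) => c₀) W f b‖ ≤ F) (x : TSite d (towerP L m (n + 1))),
        ‖WL2.equiv ℂ (fun _ : TSite d (towerP L m (n + 1)) => c₀) W (GpOfUk L m n φ η U a' (c₁ := c₁) hpos' (covDivL2K ℂ c₀ ((η : ℂ))⁻¹ (adTransportW φ fun bb => (U bb)⁻¹) f)) x‖ ≤
          Ba * Real.exp (-(δa * tdist m (blockCoord (L ^ (n + 1)) m (siteCast (towerP_eq_fineP_pow L m (n + 1)) x)) v)) * F ∧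
        ∀ x' : TSite d (towerP L m (n + 1)), tdist (towerP L m (n + 1)) x x' ≤ ((L ^ (n + 1) : ℕ) : ℝ) →
          ‖WL2.equiv ℂ (fun _ : TSite d (towerP L m (n + 1)) => c₀) W (GpOfUk L m n φ η U a' (c₁ := c₁) hpos' (covDivL2K ℂ c₀ ((η : ℂ))⁻¹ (adTransportW φ fun bb => (U bb)⁻¹) f)) x' - WL2.equiv ℂ (fun _ : TSite d (towerP L m (n + 1)) => c₀) W (GpOfUk L m n φ η U a' (c₁ := c₁) hpos' (covDivL2K ℂ c₀ ((η : ℂ))⁻¹ (adTransportW φ fun bb => (U bb)⁻¹) f)) x‖ ≤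
            Ba * Real.exp (-(δa * tdist m (blockCoord (L ^ (n + 1)) m (siteCast (towerP_eq_fineP_pow L m (n + 1)) x)) v)) * (tdist (towerP L m (n + 1)) x x' / ((L ^ (n + 1) : ℕ) : ℝ)) ^ ε * F := by
  obtain ⟨ε, αh, Bh, δh, hε0, hε1, hαh, hBh, hδh, HH⟩ := HLaH
  obtain ⟨αv, Bv, δv, hαv, hBv, hδv, HV⟩ := exists_valueRow_GpOfUk_covDiv L hL3 φ hMφ hMφ' hφ hφ' ha' hϱ0 hϱ1 τ hτ₂ hφτ hd
  refine ⟨ε, min αv αh, max Bv Bh, min δv δh, hε0, hε1, lt_min hαv hαh, le_max_of_le_left hBv, lt_min hδv hδh, ?_⟩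
  intro n η hηL c₀ c₁ _ _ hw hρ m _ hm U αU hα0 hα1 hU1 hreg εU hεU hUε hLb α hα hαle hUst hUb hUη hpl hUgrad hRlev hεg hAQ hpos' hpos hposπ hc₀ hJ v f F hfv hfF x
  have hF : 0 ≤ F := (norm_nonneg _).trans (hfF (x, ⟨0, hd⟩))
  set D : ℝ := tdist m (blockCoord (L ^ (n + 1)) m (siteCast (towerP_eq_fineP_pow L m (n + 1)) x)) v with hD
  have hD0 : 0 ≤ D := tdist_nonneg m _ _
  have hBmax : 0 ≤ max Bv Bh := le_max_of_le_left hBv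
  have hev : Bv * Real.exp (-(δv * D)) ≤ max Bv Bh * Real.exp (-(min δv δh * D)) :=
    mul_le_mul (le_max_left _ _) (Real.exp_le_exp.2 (by nlinarith [mul_le_mul_of_nonneg_right (min_le_left δv δh) hD0])) (Real.exp_pos _).le hBmax
  have heh : Bh * Real.exp (-(δh * D)) ≤ max Bv Bh * Real.exp (-(min δv δh * D)) :=
    mul_le_mul (le_max_right _ _) (Real.exp_le_exp.2 (by nlinarith [mul_le_mul_of_nonneg_right (min_le_right δv δh) hD0])) (Real.exp_pos _).le hBmax
  refine ⟨?_, fun x' hxx => ?_⟩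
  · have h := HV n η hηL c₀ c₁ hw m U α hα (hαle.trans (min_le_left _ _)) hUb hUη hUgrad εU hεU hεg hUε hLb hUst hRlev hpos' v f F hfv hfF x
    exact h.trans (mul_le_mul_of_nonneg_right hev hF)
  · have h := (HH n η hηL c₀ c₁ hw hρ m hm U αU hα0 hα1 hU1 hreg εU hεU hUε hLb α hα (hαle.trans (min_le_right _ _)) hUst hUb hUη hpl hUgrad hRlev hεg hAQ
      hpos' hpos hposπ hc₀ hJ v f F hfv hfF x) x' hxx
    have hq : 0 ≤ (tdist (towerP L m (n + 1)) x x' / ((L ^ (n + 1) : ℕ) : ℝ)) ^ ε * F :=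
      mul_nonneg (Real.rpow_nonneg (div_nonneg (tdist_nonneg _ _ _) (Nat.cast_nonneg _)) ε) hF
    calc _ ≤ Bh * Real.exp (-(δh * D)) * (tdist (towerP L m (n + 1)) x x' / ((L ^ (n + 1) : ℕ) : ℝ)) ^ ε * F := h
      _ = Bh * Real.exp (-(δh * D)) * ((tdist (towerP L m (n + 1)) x x' / ((L ^ (n + 1) : ℕ) : ℝ)) ^ ε * F) := by ring
      _ ≤ max Bv Bh * Real.exp (-(min δv δh * D)) * ((tdist (towerP L m (n + 1)) x x' / ((L ^ (n + 1) : ℕ) : ℝ)) ^ ε * F) := mul_le_mul_of_nonneg_right heh hq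
      _ = _ := by ring

set_option maxHeartbeats 800000 in -- three ≈ 50-binder blocks
include hd hL hL3 hMφ hMφ' hφ hφ' hstar ha ha' hϱ0 hϱ1 hτ hCτ hτm hMτ hρw hτ₁ hτ₂ hφτ in
/-- **THE HEADLINE OF STOREY H WITH THE VALUE MEMBER DISCHARGED: the (117) socket `‖toCLM115 ∇_U 𝔊̃_k‖ ≤ max(w̄₀B, w̄₁B)·w̲⁻¹` for the FULL `𝔊̃_k` ON THE MODEL from
(HLaH) = [B9] Thm 3.1 (3.43)₂ for `G′_kD*_U` (Hölder member alone) and (HLb) = Thm 3.1 (3.44) for `G′_k`** — gen 92's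
`exists_norm_toCLM115_frakGkPi_le_of_twoHolderMembers` with (HLa₀) := `twoMembers_of_holderMember HLaH`.
[cite: Balaban1985Variational, (117) p.295; Balaban1985BackgroundPropagators, Thm 3.13 p.426, Thm 3.1 (3.42)–(3.44) pp.397–398, (3.152)–(3.153) p.426, (3.25) p.394] -/
theorem exists_norm_toCLM115_frakGkPi_le_of_holderMember_hessian
    (HLaH : ∃ ε αa Ba δa : ℝ, 0 < ε ∧ ε ≤ 1 ∧ 0 < αa ∧ 0 ≤ Ba ∧ 0 < δa ∧
      ∀ (n : ℕ) (η : ℝ) (_hηL : η * (L : ℝ) ^ (n + 1) = 1) (c₀ c₁ : ℝ) [Fact (0 < c₀)] [Fact (0 < c₁)]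
        (_hw : c₀ * ((L : ℝ) ^ (n + 1)) ^ d = c₁) (_hρ : |η| ^ d / c₀ ≤ ρw) (m : Fin d → ℕ) [∀ i, NeZero (m i)] (_hm : ∀ i, 1 ≤ m i)
        (U : Bond d (towerP L m (n + 1)) → 𝔸ˣ) (αU : ℕ → ℝ) (_hα0 : ∀ j, 0 ≤ αU j) (hα1 : ∀ j, αU j ≤ 1 / 64)
        (hU1 : ∀ (j : ℕ) (x : B7Prop1Explicit.Site d) (k : Fin d), perCfg (towerP L m (j + 1)) (UlevOf L m (n + 1) U j) x k ∈ U1 𝔸)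
        (hreg : ∀ (j : ℕ) (y : TSite d (towerP L m j)) (k : Fin d) (ρ' : Fin d → Fin L),
          ‖((Wcx L (perCfg (towerP L m (j + 1)) (UlevOf L m (n + 1) U j)) (cornerSite L y) k (boxVec L ρ') : 𝔸ˣ) : 𝔸) - 1‖ ≤ αU j)
        (εU : ℕ → ℝ) (_hεU : ∀ j, 0 ≤ εU j) (_hUε : ∀ (j : ℕ) (b : Bond d (towerP L m (j + 1))), ‖(UlevOf L m (n + 1) U j b : 𝔸) - 1‖ ≤ εU j)
        (_hLb : ∀ (j : ℕ) (b : Bond d (towerP L m (j + 1))), UlevOf L m (n + 1) U j b ∈ U1 𝔸)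
        (α : ℝ) (_hα : 0 ≤ α) (_hαle : α ≤ αa)
        (hUst : ∀ b, star (U b : 𝔸) = (((U b)⁻¹ : 𝔸ˣ) : 𝔸)) (_hUb : ∀ b, U b ∈ U1 𝔸) (_hUη : ∀ b, ‖(U b : 𝔸) - 1‖ ≤ α * η)
        (_hpl : ∀ p : B9SectCLatticeCarrier.Plaq d (towerP L m (n + 1)), ‖(plaqHolU U p : 𝔸) - 1‖ ≤ α * η ^ 2)
        (_hUgrad : ∀ (x : TSite d (towerP L m (n + 1))) (μ : Fin d), ‖(U (x, μ) : 𝔸) - U (unshift μ x, μ)‖ ≤ α * η ^ 2)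
        (_hRlev : ∀ (j : ℕ) (b : Bond d (towerP L m (j + 1))) (w : W), ‖adTransportW φ (UlevOf L m (n + 1) U j) b w‖ ≤ ‖w‖)
        (_hεg : ∀ j < n + 1, εU j ≤ α * ϱ ^ j) (_hAQ : ∑ j ∈ Finset.range (n + 1), αU j ≤ AQ)
        (hpos' : ∀ x : SiteL2K ℂ d (towerP L m (n + 1)) c₀ W, x ≠ 0 → 0 < RCLike.re ⟪x, laplacePrimeAk L m n φ η U a' (c₁ := c₁) x⟫_ℂ)
        (hpos : ∀ x : BondL2K ℂ d (towerP L m (n + 1)) c₀ W, x ≠ 0 →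
          0 < RCLike.re ⟪x, laplaceAk L m n φ η U hL αU hα1 hU1 hreg τ (c₀ := c₀) (c₁ := c₁) a x⟫_ℂ)
        (hposπ : ∀ x : BondL2K ℂ d (towerP L m (n + 1)) c₀ W, x ≠ 0 →
          0 < RCLike.re ⟪x, laplaceAkPi L m n φ τ η U a' hpos' hL αU hα1 hU1 hreg (c₁ := c₁) a x⟫_ℂ)
        (_hc₀ : c₀ = η ^ d)
        (_hJ : ∀ (μ : Fin d) (y : TSite d (towerP L m (n + 1))),
          ‖B9Eq39Adjoint.J (fun μ => B9Eq33CovDerivVector.shiftEquiv μ) (fun μ y => U (y, μ)) η μ y‖ ≤ α)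
        (v : TSite d m) (f : BondL2K ℂ d (towerP L m (n + 1)) c₀ W) (F : ℝ)
        (_hfv : ∀ b, blockCoord (L ^ (n + 1)) m (siteCast (towerP_eq_fineP_pow L m (n + 1)) (bpos b)) ≠ v →
          WL2.equiv ℂ (fun _ : Bond d (towerP L m (n + 1)) => c₀) W f b = 0)
        (_hfF : ∀ b, ‖WL2.equiv ℂ (fun _ : Bond d (towerP L m (n + 1)) => c₀) W f b‖ ≤ F) (x : TSite d (towerP L m (n + 1))),
        ∀ x' : TSite d (towerP L m (n + 1)), tdist (towerP L m (n + 1)) x x' ≤ ((L ^ (n + 1) : ℕ) : ℝ) →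
          ‖WL2.equiv ℂ (fun _ : TSite d (towerP L m (n + 1)) => c₀) W (GpOfUk L m n φ η U a' (c₁ := c₁) hpos' (covDivL2K ℂ c₀ ((η : ℂ))⁻¹ (adTransportW φ fun bb => (U bb)⁻¹) f)) x' - WL2.equiv ℂ (fun _ : TSite d (towerP L m (n + 1)) => c₀) W (GpOfUk L m n φ η U a' (c₁ := c₁) hpos' (covDivL2K ℂ c₀ ((η : ℂ))⁻¹ (adTransportW φ fun bb => (U bb)⁻¹) f)) x‖ ≤
            Ba * Real.exp (-(δa * tdist m (blockCoord (L ^ (n + 1)) m (siteCast (towerP_eq_fineP_pow L m (n + 1)) x)) v)) * (tdist (towerP L m (n + 1)) x x' / ((L ^ (n + 1) : ℕ) : ℝ)) ^ ε * F)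
    (HLb : ∀ ε : ℝ, 0 < ε → ε ≤ 1 → ∃ αb Bb δb : ℝ, 0 < αb ∧ 0 ≤ Bb ∧ 0 < δb ∧
      ∀ (n : ℕ) (η : ℝ) (_hηL : η * (L : ℝ) ^ (n + 1) = 1) (c₀ c₁ : ℝ) [Fact (0 < c₀)] [Fact (0 < c₁)]
        (_hw : c₀ * ((L : ℝ) ^ (n + 1)) ^ d = c₁) (_hρ : |η| ^ d / c₀ ≤ ρw) (m : Fin d → ℕ) [∀ i, NeZero (m i)] (_hm : ∀ i, 1 ≤ m i)
        (U : Bond d (towerP L m (n + 1)) → 𝔸ˣ) (αU : ℕ → ℝ) (_hα0 : ∀ j, 0 ≤ αU j) (hα1 : ∀ j, αU j ≤ 1 / 64)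
        (hU1 : ∀ (j : ℕ) (x : B7Prop1Explicit.Site d) (k : Fin d), perCfg (towerP L m (j + 1)) (UlevOf L m (n + 1) U j) x k ∈ U1 𝔸)
        (hreg : ∀ (j : ℕ) (y : TSite d (towerP L m j)) (k : Fin d) (ρ' : Fin d → Fin L),
          ‖((Wcx L (perCfg (towerP L m (j + 1)) (UlevOf L m (n + 1) U j)) (cornerSite L y) k (boxVec L ρ') : 𝔸ˣ) : 𝔸) - 1‖ ≤ αU j)
        (εU : ℕ → ℝ) (_hεU : ∀ j, 0 ≤ εU j) (_hUε : ∀ (j : ℕ) (b : Bond d (towerP L m (j + 1))), ‖(UlevOf L m (n + 1) U j b : 𝔸) - 1‖ ≤ εU j)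
        (_hLb : ∀ (j : ℕ) (b : Bond d (towerP L m (j + 1))), UlevOf L m (n + 1) U j b ∈ U1 𝔸)
        (α : ℝ) (_hα : 0 ≤ α) (_hαle : α ≤ αb)
        (hUst : ∀ b, star (U b : 𝔸) = (((U b)⁻¹ : 𝔸ˣ) : 𝔸)) (_hUb : ∀ b, U b ∈ U1 𝔸) (_hUη : ∀ b, ‖(U b : 𝔸) - 1‖ ≤ α * η)
        (_hpl : ∀ p : B9SectCLatticeCarrier.Plaq d (towerP L m (n + 1)), ‖(plaqHolU U p : 𝔸) - 1‖ ≤ α * η ^ 2)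
        (_hUgrad : ∀ (x : TSite d (towerP L m (n + 1))) (μ : Fin d), ‖(U (x, μ) : 𝔸) - U (unshift μ x, μ)‖ ≤ α * η ^ 2)
        (_hRlev : ∀ (j : ℕ) (b : Bond d (towerP L m (j + 1))) (w : W), ‖adTransportW φ (UlevOf L m (n + 1) U j) b w‖ ≤ ‖w‖)
        (_hεg : ∀ j < n + 1, εU j ≤ α * ϱ ^ j) (_hAQ : ∑ j ∈ Finset.range (n + 1), αU j ≤ AQ)
        (hpos' : ∀ x : SiteL2K ℂ d (towerP L m (n + 1)) c₀ W, x ≠ 0 → 0 < RCLike.re ⟪x, laplacePrimeAk L m n φ η U a' (c₁ := c₁) x⟫_ℂ)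
        (hpos : ∀ x : BondL2K ℂ d (towerP L m (n + 1)) c₀ W, x ≠ 0 →
          0 < RCLike.re ⟪x, laplaceAk L m n φ η U hL αU hα1 hU1 hreg τ (c₀ := c₀) (c₁ := c₁) a x⟫_ℂ)
        (hposπ : ∀ x : BondL2K ℂ d (towerP L m (n + 1)) c₀ W, x ≠ 0 →
          0 < RCLike.re ⟪x, laplaceAkPi L m n φ τ η U a' hpos' hL αU hα1 hU1 hreg (c₁ := c₁) a x⟫_ℂ)
        (_hc₀ : c₀ = η ^ d)
        (_hJ : ∀ (μ : Fin d) (y : TSite d (towerP L m (n + 1))),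
          ‖B9Eq39Adjoint.J (fun μ => B9Eq33CovDerivVector.shiftEquiv μ) (fun μ y => U (y, μ)) η μ y‖ ≤ α)
        (y' : TSite d m) (lam : SiteL2K ℂ d (towerP L m (n + 1)) c₀ W) (N H : ℝ) (_hN : 0 ≤ N) (_hH : 0 ≤ H)
        (_hsupp : ∀ x, WL2.equiv ℂ (fun _ : TSite d (towerP L m (n + 1)) => c₀) W lam x ≠ 0 → tdist m (blockCoord (L ^ (n + 1)) m (siteCast (towerP_eq_fineP_pow L m (n + 1)) x)) y' ≤ 1)
        (_hval : ∀ x, ‖WL2.equiv ℂ (fun _ : TSite d (towerP L m (n + 1)) => c₀) W lam x‖ ≤ N)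
        (_hhol : ∀ x x' : TSite d (towerP L m (n + 1)), tdist (towerP L m (n + 1)) x x' ≤ ((L ^ (n + 1) : ℕ) : ℝ) →
          ‖WL2.equiv ℂ (fun _ : TSite d (towerP L m (n + 1)) => c₀) W lam x' - WL2.equiv ℂ (fun _ : TSite d (towerP L m (n + 1)) => c₀) W lam x‖ ≤ H * (tdist (towerP L m (n + 1)) x x' / ((L ^ (n + 1) : ℕ) : ℝ)) ^ ε)
        (μ : Fin d) (b : Bond d (towerP L m (n + 1))),
        ‖WL2.equiv ℂ (fun _ : Bond d (towerP L m (n + 1)) => c₀) W (covDerivL2K ℂ c₀ ((η : ℂ))⁻¹ (adTransportW φ U)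
            ((WL2.equiv ℂ (fun _ : TSite d (towerP L m (n + 1)) => c₀) W).symm fun y => WL2.equiv ℂ (fun _ : Bond d (towerP L m (n + 1)) => c₀) W (covDerivL2K ℂ c₀ ((η : ℂ))⁻¹ (adTransportW φ U) (GpOfUk L m n φ η U a' (c₁ := c₁) hpos' lam)) (y, μ))) b‖ ≤
          Bb * Real.exp (-(δb * tdist m (blockCoord (L ^ (n + 1)) m (siteCast (towerP_eq_fineP_pow L m (n + 1)) (bpos b))) y')) * (N + H)) :
    ∃ α₁ j₁ B : ℝ, 0 < α₁ ∧ 0 < j₁ ∧ 0 ≤ B ∧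
      ∀ (n : ℕ) (η : ℝ) (_hηL : η * (L : ℝ) ^ (n + 1) = 1) (c₀ c₁ : ℝ) [Fact (0 < c₀)] [Fact (0 < c₁)]
        (_hw : c₀ * ((L : ℝ) ^ (n + 1)) ^ d = c₁) (_hρ : |η| ^ d / c₀ ≤ ρw) (m : Fin d → ℕ) [∀ i, NeZero (m i)] (_hm : ∀ i, 1 ≤ m i)
        (U : Bond d (towerP L m (n + 1)) → 𝔸ˣ) (αU : ℕ → ℝ) (_hα0 : ∀ j, 0 ≤ αU j) (hα1 : ∀ j, αU j ≤ 1 / 64)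
        (hαL : ∀ j, 50 * (d + 1) * αU j * (L : ℝ) ^ d ≤ 1 / 2)
        (hU1 : ∀ (j : ℕ) (x : B7Prop1Explicit.Site d) (k : Fin d), perCfg (towerP L m (j + 1)) (UlevOf L m (n + 1) U j) x k ∈ U1 𝔸)
        (hreg : ∀ (j : ℕ) (y : TSite d (towerP L m j)) (k : Fin d) (ρ' : Fin d → Fin L),
          ‖((Wcx L (perCfg (towerP L m (j + 1)) (UlevOf L m (n + 1) U j)) (cornerSite L y) k (boxVec L ρ') : 𝔸ˣ) : 𝔸) - 1‖ ≤ αU j)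
        (εU : ℕ → ℝ) (_hεU : ∀ j, 0 ≤ εU j) (_hUε : ∀ (j : ℕ) (b : Bond d (towerP L m (j + 1))), ‖(UlevOf L m (n + 1) U j b : 𝔸) - 1‖ ≤ εU j)
        (_hLb : ∀ (j : ℕ) (b : Bond d (towerP L m (j + 1))), UlevOf L m (n + 1) U j b ∈ U1 𝔸)
        (α : ℝ) (_hα : 0 ≤ α) (_hαle : α ≤ α₁)
        (hUst : ∀ b, star (U b : 𝔸) = (((U b)⁻¹ : 𝔸ˣ) : 𝔸)) (_hUb : ∀ b, U b ∈ U1 𝔸) (_hUη : ∀ b, ‖(U b : 𝔸) - 1‖ ≤ α * η)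
        (_hpl : ∀ p : B9SectCLatticeCarrier.Plaq d (towerP L m (n + 1)), ‖(plaqHolU U p : 𝔸) - 1‖ ≤ α * η ^ 2)
        (_hUgrad : ∀ (x : TSite d (towerP L m (n + 1))) (μ : Fin d), ‖(U (x, μ) : 𝔸) - U (unshift μ x, μ)‖ ≤ α * η ^ 2)
        (_hRlev : ∀ (j : ℕ) (b : Bond d (towerP L m (j + 1))) (w : W), ‖adTransportW φ (UlevOf L m (n + 1) U j) b w‖ ≤ ‖w‖)
        (_hεg : ∀ j < n + 1, εU j ≤ α * ϱ ^ j) (_hAQ : ∑ j ∈ Finset.range (n + 1), αU j ≤ AQ)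
        (hpos' : ∀ x : SiteL2K ℂ d (towerP L m (n + 1)) c₀ W, x ≠ 0 → 0 < RCLike.re ⟪x, laplacePrimeAk L m n φ η U a' (c₁ := c₁) x⟫_ℂ)
        (hpos : ∀ x : BondL2K ℂ d (towerP L m (n + 1)) c₀ W, x ≠ 0 →
          0 < RCLike.re ⟪x, laplaceAk L m n φ η U hL αU hα1 hU1 hreg τ (c₀ := c₀) (c₁ := c₁) a x⟫_ℂ)
        (_hc₀η : c₀ = η ^ d) (j₀ : ℝ) (_hJ : ∀ μ y, ‖B9Eq39Adjoint.J (fun μ => B9Eq33CovDerivVector.shiftEquiv μ) (fun μ y => U (y, μ)) η μ y‖ ≤ j₀) (_hj : j₀ ≤ j₁)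
        (hposπ : ∀ x : BondL2K ℂ d (towerP L m (n + 1)) c₀ W, x ≠ 0 →
          0 < RCLike.re ⟪x, laplaceAkPi L m n φ τ η U a' hpos' hL αU hα1 hU1 hreg (c₁ := c₁) a x⟫_ℂ)
        (hQ : Function.Surjective (QkW L m n φ U hL αU hα1 hU1 hreg (c₀ := c₀) (c₁ := c₁)))
        (Lw ηw : ℝ) [Fact (0 < Lw)] [Fact (0 < ηw)] (lev₀ : Bond d (towerP L m (n + 1)) → ℕ) (lev₁ : Bond d (towerP L m (n + 1)) × Fin d → ℕ),
        ‖toCLM115 (L := Lw) (η := ηw) (lev₀ := lev₀) lev₁ (covGrad ((η : ℂ))⁻¹ (adTransportW φ U))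
            ((WL2.linearEquiv ℂ ℂ (fun _ : Bond d (towerP L m (n + 1)) => c₀)).toLinearMap ∘ₗ (frakGLatticeK hposπ hQ : _ →ₗ[ℂ] _) ∘ₗ
              ((WL2.linearEquiv ℂ ℂ (fun _ : Bond d (towerP L m (n + 1)) => c₀)).symm.toLinearMap :
                (Bond d (towerP L m (n + 1)) → W) →ₗ[ℂ] BondL2K ℂ d (towerP L m (n + 1)) c₀ W))‖ ≤
          max ((NegSup.wSup (levWeight Lw ηw lev₀ 1) : ℝ) * B) (NegSup.wSup (levWeight Lw ηw lev₁ 2) * B) *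
            NegSup.wInvSup (levWeight Lw ηw lev₀ 3) :=
  exists_norm_toCLM115_frakGkPi_le_of_twoHolderMembers hd L hL hL3 φ hMφ hMφ' hφ hφ' hstar ha ha' hϱ0 hϱ1 τ hτ hCτ hτm hMτ hρw hτ₁ hτ₂ hφτ AQ
    (twoMembers_of_holderMember hd L hL hL3 φ hMφ hMφ' hφ hφ' ha' hϱ0 hϱ1 τ hτ₂ hφτ AQ HLaH) HLb

end Literature.MathematicalPhysics.QuantumFieldTheory.Balaban1983to89.B9Eq3152StoreyHValueMemberClosed

end
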